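import Mathlib
import HarnessLib
import Summits.NavierStokesRegularity.NavierStokesRegularity.Theorems.TypeILiouvilleAxisymSectors
import Literature.Analysis.FluidPDE.SelfSimilarLiouvilleSwirlDecayProofs
import Literature.Analysis.FluidPDE.LeiZhangZhao2017LiouvilleSwirlLp
import Literature.Analysis.FluidPDE.LeiRenZhang2019Liouville

/-!
# TypeILiouvilleAxisymSwirlStrata — crux (L) stmt-NavierStokesRegularity-10661 `TypeIliouvilleL`:
# THE PROVED SWIRL STRATA OF THE AXISYMMETRIC CELL (Lei–Zhang–Zhao 2017, Lei–Ren–Zhang 2019) ON PRINT'S CLASS, LOCALIZED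

Helper for stmt-NavierStokesRegularity-10661 (`--supports`); theorems only, no definitions, no named-fact hypotheses;
closes no item; Navier–Stokes regularity is NOT proved here (leafhand seat of the EulerZoomLiouville route; sequel to
`TypeILiouvilleAxisymSectors` / `TypeILiouvilleAxisymPeriodicSector`).  Class P = print's class of bounded ancient mild
solutions; `Γ = swirl (v t) = x₀v₁ − x₁v₀` (`= r v_θ`).

The axisymmetric-WITH-swirl cell AXL of the (L) residual (KNSS 2009 p. 10) has, besides KNSS Thm 5.3 and the `z`-periodic
stratum, three further strata that are PROVED THEOREMS OF THE TREE in the duality-form class: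
`leiZhangZhao2017_liouville_swirl_decay_holds` (Lei–Zhang–Zhao 2017 Rem. 1.4: `Γ → 0` at radial infinity uniformly in
`z, t`), `leiZhangZhao2017_liouville_swirl_Lp_holds` (Thm 1.3: `Γ ∈ L^∞_t L^p_x`, `1 ≤ p < ∞`),
`leiRenZhang2019_liouville_swirl_rate_holds` (Lei–Ren–Zhang Thm 1.2: `Γ` bounded with `|Γ² − L²| ≤ ε₀(M)L²/r` in the far
field).  This file transports them to class P (conclusion: ONE constant axial vector) and localizes the axisymmetry to one
patch of one slice:

* §1 `classP_axial_of_axisymmetric_swirlDecay`, `classP_axial_of_axisymmetric_swirlLp`,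
  `classP_axial_of_axisymmetric_swirlRate` (global axisymmetry);
* §2 `classP_axial_of_locally_axisymmetric_swirlDecay`, `…_swirlLp`, `…_swirlRate` (rotational symmetry certified on
  ONE nonempty open patch of ONE slice, `classP_isAxisymmetric_of_locally`).

READING for the census of AXL on L_Q / S3ᵐ / BCL / LSL's class: CLOSED strata = no swirl (local), `|v| ≤ C/r` (far
field/far past), `Γ → 0` radially, `Γ ∈ L^∞_t L^p_x`, `Γ` bounded & `z`-periodic (local), LRZ rate; OPEN core = bounded
ancient axisymmetric flows whose swirl neither decays radially nor is `L^p` nor periodic-with-bound nor rate-pinned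
(in print: Lei–Zhang 2011 `b ∈ L^∞(BMO^{-1})` not typed here).
[cite: LeiZhangZhao2017, Rem. 1.4 and Thm 1.3 (arXiv:1701.00868 p. 4)] [cite: LeiRenZhang2019, Thm 1.2 (arXiv:1902.11229 p. 4)]
[cite: KochNadirashviliSereginSverak2009, Remark 6.1, p. 10 (arXiv:0709.3599)] [cite: LemarieRieusset2016, Thm. 9.12 (PDF p. 260)]
-/

noncomputable section

open MeasureTheory Filter Set Function Metric
open scoped Topology ENNReal NNReal
open Literature.Analysis Literature.Analysis.FluidPDE Literature.Analysis.UnboundedOperators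
open Summit.NavierStokesRegularity.NavierStokesRegularity.Theorems.TypeILiouvilleShoreline
open Summit.NavierStokesRegularity.NavierStokesRegularity.Theorems.TypeILiouvilleAxisymSectors

set_option linter.dupNamespace false

namespace Summit.NavierStokesRegularity.NavierStokesRegularity.Theorems.TypeILiouvilleAxisymSectors

variable {v : ℝ → EuclideanSpace ℝ (Fin 3) → EuclideanSpace ℝ (Fin 3)}

/-- Gluing lemma: if every slice of a class-P flow is a.e. an axial constant, the flow is ONE constant axial vector
(continuity of slices + KNSS Remark 6.1). [cite: KochNadirashviliSereginSverak2009, Remark 6.1 (arXiv:0709.3599)] -/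
theorem classP_axial_of_slices_ae_axial
    (hc : ContinuousOn (uncurry v) (Iio 0 ×ˢ univ))
    (hm : ∀ s t : ℝ, s < t → t < 0 → ∀ x,
      v t x = heatExtension (v s) (t - s) x - oseenDuhamel 1 s v v t x)
    (hae : ∀ t < 0, ∃ β : ℝ, v t =ᵐ[volume] fun _ => β • eZ) :
    ∃ β : ℝ, ∀ t < 0, ∀ x, v t x = β • eZ := by
  classical
  have hvc : ∀ t < 0, Continuous (v t) := fun t ht =>
    hc.comp_continuous (Continuous.prodMk_right t) fun x => mem_prod.2 ⟨ht, mem_univ x⟩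
  have hslice : ∀ t < 0, ∃ β : ℝ, ∀ x, v t x = β • eZ := by
    intro t ht
    obtain ⟨β, hβ⟩ := hae t ht
    have : v t = fun _ => β • eZ := (Continuous.ae_eq_iff_eq volume (hvc t ht) continuous_const).1 hβ
    exact ⟨β, fun x => congrFun this x⟩
  set β : ℝ → ℝ := fun t => if ht : t < 0 then Classical.choose (hslice t ht) else 0 with hβ_def
  have hub : ∀ t < 0, ∀ x, v t x = β t • eZ := by
    intro t ht x
    have h := Classical.choose_spec (hslice t ht) x
    simp only [hβ_def, dif_pos ht]
    exact h
  have htime := classP_sliceConst_agree hm (b := fun t => β t • eZ) hub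
  refine ⟨β (-1), fun t ht x => ?_⟩
  rw [hub t ht x]
  exact htime t (-1) ht (by norm_num)

/-! ## §1 The three swirl strata on class P -/

/-- **Lei–Zhang–Zhao 2017 Rem. 1.4 on class P**: axisymmetric with swirl `Γ → 0` at radial infinity uniformly in `z, t`
⟹ ONE constant axial vector. [cite: LeiZhangZhao2017, Rem. 1.4 with Lemma 5.2 (arXiv:1701.00868 p. 4, pp. 11–12)] -/
theorem classP_axial_of_axisymmetric_swirlDecay
    (hc : ContinuousOn (uncurry v) (Iio 0 ×ˢ univ))
    (hK : ∃ K : ℝ, ∀ t < 0, ∀ x, ‖v t x‖ ≤ K)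
    (hd : ∀ t < 0, IsWeaklyDivFree (v t))
    (hm : ∀ s t : ℝ, s < t → t < 0 → ∀ x,
      v t x = heatExtension (v s) (t - s) x - oseenDuhamel 1 s v v t x)
    (haxi : ∀ t < 0, IsAxisymmetric (v t))
    (hdecay : ∀ ε : ℝ, 0 < ε → ∃ R : ℝ, ∀ t < 0, ∀ x, R ≤ cylRadius x → |swirl (v t) x| ≤ ε) :
    ∃ β : ℝ, ∀ t < 0, ∀ x, v t x = β • eZ := by
  obtain ⟨hv, -, hmeas⟩ := classP_isBoundedAncientMildSolution hc hK hd hm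
  exact classP_axial_of_slices_ae_axial hc hm
    (leiZhangZhao2017_liouville_swirl_decay_holds v hv hmeas haxi hdecay)

/-- **Lei–Zhang–Zhao 2017 Thm 1.3 on class P**: axisymmetric with `Γ ∈ L^∞_t L^p_x` (`1 ≤ p < ∞`) ⟹ ONE constant axial
vector. [cite: LeiZhangZhao2017, Thm 1.3 (arXiv:1701.00868 p. 4)] -/
theorem classP_axial_of_axisymmetric_swirlLp
    (hc : ContinuousOn (uncurry v) (Iio 0 ×ˢ univ))
    (hK : ∃ K : ℝ, ∀ t < 0, ∀ x, ‖v t x‖ ≤ K)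
    (hd : ∀ t < 0, IsWeaklyDivFree (v t))
    (hm : ∀ s t : ℝ, s < t → t < 0 → ∀ x,
      v t x = heatExtension (v s) (t - s) x - oseenDuhamel 1 s v v t x)
    (haxi : ∀ t < 0, IsAxisymmetric (v t))
    (hLp : ∃ (p : ℝ≥0∞) (K : ℝ≥0), 1 ≤ p ∧ p < (⊤ : ℝ≥0∞) ∧ ∀ t < 0, eLpNorm (swirl (v t)) p volume ≤ K) :
    ∃ β : ℝ, ∀ t < 0, ∀ x, v t x = β • eZ := by
  obtain ⟨hv, -, hmeas⟩ := classP_isBoundedAncientMildSolution hc hK hd hm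
  exact classP_axial_of_slices_ae_axial hc hm
    (leiZhangZhao2017_liouville_swirl_Lp_holds v hv hmeas haxi hLp)

/-- **Lei–Ren–Zhang 2019 Thm 1.2 on class P**: for every velocity bound `M` there is `ε₀ ∈ (0,1)` such that an axisymmetric
class-P flow with `‖v‖ ≤ M`, bounded swirl, and the far-field rate condition `|Γ² − L²| ≤ ε₀L²/r` (`r ≥ R₀`) is ONE constant
axial vector. [cite: LeiRenZhang2019, Thm 1.2 (arXiv:1902.11229 p. 4)] -/
theorem classP_axial_of_axisymmetric_swirlRate (M : ℝ) :
    ∃ ε₀ ∈ Set.Ioo (0 : ℝ) 1, ∀ v : ℝ → EuclideanSpace ℝ (Fin 3) → EuclideanSpace ℝ (Fin 3),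
      ContinuousOn (uncurry v) (Iio 0 ×ˢ univ) →
      (∀ t < 0, ∀ x, ‖v t x‖ ≤ M) →
      (∀ t < 0, IsWeaklyDivFree (v t)) →
      (∀ s t : ℝ, s < t → t < 0 → ∀ x,
        v t x = heatExtension (v s) (t - s) x - oseenDuhamel 1 s v v t x) →
      (∀ t < 0, IsAxisymmetric (v t)) →
      (∃ C : ℝ, ∀ t < 0, ∀ x, |swirl (v t) x| ≤ C) →
      (∃ L R₀ : ℝ, ∀ t < 0, ∀ x, R₀ ≤ cylRadius x → |swirl (v t) x ^ 2 - L ^ 2| ≤ ε₀ * L ^ 2 / cylRadius x) →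
      ∃ β : ℝ, ∀ t < 0, ∀ x, v t x = β • eZ := by
  obtain ⟨ε₀, hε₀, hrate⟩ := leiRenZhang2019_liouville_swirl_rate_holds M
  refine ⟨ε₀, hε₀, fun v hc hM hd hm haxi hsw hL => ?_⟩
  obtain ⟨hv, -, hmeas⟩ := classP_isBoundedAncientMildSolution hc ⟨M, hM⟩ hd hm
  exact classP_axial_of_slices_ae_axial hc hm (hrate v hv hM hmeas haxi hsw hL)

/-! ## §2 Localized axisymmetry -/

/-- **LZZ Rem. 1.4, localized**: rotational symmetry certified on ONE nonempty open patch of ONE slice + radially decaying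
swirl ⟹ ONE constant axial vector. [cite: LeiZhangZhao2017, Rem. 1.4 (arXiv:1701.00868 p. 4); LemarieRieusset2016, Thm. 9.12] -/
theorem classP_axial_of_locally_axisymmetric_swirlDecay
    (hc : ContinuousOn (uncurry v) (Iio 0 ×ˢ univ))
    (hK : ∃ K : ℝ, ∀ t < 0, ∀ x, ‖v t x‖ ≤ K)
    (hd : ∀ t < 0, IsWeaklyDivFree (v t))
    (hm : ∀ s t : ℝ, s < t → t < 0 → ∀ x,
      v t x = heatExtension (v s) (t - s) x - oseenDuhamel 1 s v v t x)
    {t₀ : ℝ} (ht₀ : t₀ < 0) {U : Set (EuclideanSpace ℝ (Fin 3))} (hUo : IsOpen U) (hUne : U.Nonempty)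
    (hrot : ∀ θ : ℝ, ∀ x ∈ U, v t₀ x = rotZLIE θ (v t₀ ((rotZLIE θ).symm x)))
    (hdecay : ∀ ε : ℝ, 0 < ε → ∃ R : ℝ, ∀ t < 0, ∀ x, R ≤ cylRadius x → |swirl (v t) x| ≤ ε) :
    ∃ β : ℝ, ∀ t < 0, ∀ x, v t x = β • eZ :=
  classP_axial_of_axisymmetric_swirlDecay hc hK hd hm (classP_isAxisymmetric_of_locally hc hK hm ht₀ hUo hUne hrot) hdecay

/-- **LZZ Thm 1.3, localized**: rotational symmetry on one patch of one slice + `Γ ∈ L^∞_t L^p_x` ⟹ ONE constant axial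
vector. [cite: LeiZhangZhao2017, Thm 1.3 (arXiv:1701.00868 p. 4); LemarieRieusset2016, Thm. 9.12] -/
theorem classP_axial_of_locally_axisymmetric_swirlLp
    (hc : ContinuousOn (uncurry v) (Iio 0 ×ˢ univ))
    (hK : ∃ K : ℝ, ∀ t < 0, ∀ x, ‖v t x‖ ≤ K)
    (hd : ∀ t < 0, IsWeaklyDivFree (v t))
    (hm : ∀ s t : ℝ, s < t → t < 0 → ∀ x,
      v t x = heatExtension (v s) (t - s) x - oseenDuhamel 1 s v v t x)
    {t₀ : ℝ} (ht₀ : t₀ < 0) {U : Set (EuclideanSpace ℝ (Fin 3))} (hUo : IsOpen U) (hUne : U.Nonempty)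
    (hrot : ∀ θ : ℝ, ∀ x ∈ U, v t₀ x = rotZLIE θ (v t₀ ((rotZLIE θ).symm x)))
    (hLp : ∃ (p : ℝ≥0∞) (K : ℝ≥0), 1 ≤ p ∧ p < (⊤ : ℝ≥0∞) ∧ ∀ t < 0, eLpNorm (swirl (v t)) p volume ≤ K) :
    ∃ β : ℝ, ∀ t < 0, ∀ x, v t x = β • eZ :=
  classP_axial_of_axisymmetric_swirlLp hc hK hd hm (classP_isAxisymmetric_of_locally hc hK hm ht₀ hUo hUne hrot) hLp

/-- **LRZ Thm 1.2, localized**: for every `M` there is `ε₀ ∈ (0,1)` such that rotational symmetry on one patch of one slice,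
`‖v‖ ≤ M`, bounded swirl and the far-field rate condition at level `ε₀` force ONE constant axial vector.
[cite: LeiRenZhang2019, Thm 1.2 (arXiv:1902.11229 p. 4); LemarieRieusset2016, Thm. 9.12] -/
theorem classP_axial_of_locally_axisymmetric_swirlRate (M : ℝ) :
    ∃ ε₀ ∈ Set.Ioo (0 : ℝ) 1, ∀ v : ℝ → EuclideanSpace ℝ (Fin 3) → EuclideanSpace ℝ (Fin 3),
      ContinuousOn (uncurry v) (Iio 0 ×ˢ univ) →
      (∀ t < 0, ∀ x, ‖v t x‖ ≤ M) →
      (∀ t < 0, IsWeaklyDivFree (v t)) →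
      (∀ s t : ℝ, s < t → t < 0 → ∀ x,
        v t x = heatExtension (v s) (t - s) x - oseenDuhamel 1 s v v t x) →
      (∃ (t₀ : ℝ) (U : Set (EuclideanSpace ℝ (Fin 3))), t₀ < 0 ∧ IsOpen U ∧ U.Nonempty ∧
        ∀ θ : ℝ, ∀ x ∈ U, v t₀ x = rotZLIE θ (v t₀ ((rotZLIE θ).symm x))) →
      (∃ C : ℝ, ∀ t < 0, ∀ x, |swirl (v t) x| ≤ C) →
      (∃ L R₀ : ℝ, ∀ t < 0, ∀ x, R₀ ≤ cylRadius x → |swirl (v t) x ^ 2 - L ^ 2| ≤ ε₀ * L ^ 2 / cylRadius x) →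
      ∃ β : ℝ, ∀ t < 0, ∀ x, v t x = β • eZ := by
  obtain ⟨ε₀, hε₀, hrate⟩ := classP_axial_of_axisymmetric_swirlRate M
  refine ⟨ε₀, hε₀, fun v hc hM hd hm hloc hsw hL => ?_⟩
  obtain ⟨t₀, U, ht₀, hUo, hUne, hrot⟩ := hloc
  exact hrate v hc hM hd hm (classP_isAxisymmetric_of_locally hc ⟨M, hM⟩ hm ht₀ hUo hUne hrot) hsw hL

end Summit.NavierStokesRegularity.NavierStokesRegularity.Theorems.TypeILiouvilleAxisymSectors

end
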